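import Literature.NumberTheory.LFunctions.ApproxFunctionalEquationGap
import HarnessLib

/-!
# The approximate functional equation at `σ = 1/2` with a variable non-resonance gap, II

Topic `Literature/NumberTheory/LFunctions`; everything PROVED. Continuation of
`ApproxFunctionalEquationGap.lean`: the master inequality of Titchmarsh §4.13 with the second sum
over `ν ≤ [y]` (tree `AFE.norm_zeta_sub_sub_le_master_unbalanced`) under the weaker hypothesis
`δ ≤ {y} ≤ 1 − δ` (the two `δ`-dependent error terms carry `1/δ`; every other step is the tree's),
and its usable form with the free parameters `N, V` sent to infinity:
`‖ζ(s) − ∑_{n≤X} n^{−s} − afeCoeff(s) ∑_{ν≤[y]} ν^{s−1}‖ ≤ 4X^{−1/2} + a^{−1/2}(2/δ + 9 + 4 log(y+2))`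
for `s = 1/2 + it`, `t = 2πay`, `y ≥ 1`, `a ∈ [X, X+1]`. [cite: Titchmarsh1986, Theorem 4.13]
-/

noncomputable section

open Complex MeasureTheory Set Filter intervalIntegral Finset
open scoped Real Topology

namespace Literature.NumberTheory.LFunctions.AFE

/-! ## The master inequality with a variable gap -/

/-- **Titchmarsh §4.13 assembled, unequal lengths, variable gap.** For `s = 1/2 + it`,
`t = 2πay` with `y ≥ 1`, `{y} ∈ [δ, 1 − δ]` (`δ > 0`), `a ∈ [X, X+1]`, `1 ≤ X`, and any `N ≥ a` with `t ≤ πN` and `V ≥ max(1, [y])`,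
the quantity `ζ(s) - ∑_{n≤X} n^{-s} - afeCoeff(s) ∑_{ν≤[y]} ν^{s-1}` is bounded by the sum of the
error terms of the proof of Theorem 4.13 ((4.11.2), the block `X < n ≤ a`, the remainder of
Lemma 4.10, `x^{1-s}/(1-s)`, the two sawtooth boundary terms, the near frequencies, the integrated
terms, and the far frequencies of both signs). This is
`Literature.NumberTheory.LFunctions.AFE.norm_zeta_sub_sub_le_master` without its hypotheses
`X ≤ [y] + 1`, `[y] ≤ X + 2` and without the change of range `[y] ↔ X` (whose contribution
`3X^{-1/2}` is kept on the right as slack, so that the right-hand side is literally the same).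
[cite: Titchmarsh1986, §4.13] -/
theorem norm_zeta_sub_sub_le_master_unbalanced_of_gap {t a y δ : ℝ} {X N V : ℕ} (ht0 : 0 < t)
    (ha : 0 < a) (hy : 1 ≤ y) (hδ : 0 < δ) (hty : t = 2 * π * a * y) (hfr1 : δ ≤ Int.fract y)
    (hfr2 : Int.fract y ≤ 1 - δ) (hXa : (X : ℝ) ≤ a) (haX : a ≤ X + 1) (hX1 : 1 ≤ X)
    (haN : a ≤ N) (htN : t ≤ π * N) (hV1 : 1 ≤ V)
    (hyV : ⌊y⌋₊ ≤ V) (s : ℂ) (hs : s = 1 / 2 + t * I) :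
    ‖riemannZeta s - ∑ n ∈ Finset.Icc 1 X, (n : ℂ) ^ (-s)
        - afeCoeff s * ∑ n ∈ Finset.Icc 1 ⌊y⌋₊, (n : ℂ) ^ (s - 1)‖
      ≤ (N : ℝ) ^ (-(1 / 2 : ℝ)) * (1 / 2 + ‖s‖)
        + (X : ℝ) ^ (-(1 / 2 : ℝ))
        + ‖s‖ * a ^ (-(1 / 2 : ℝ) - 1) * (N - a + 2) * sawEta V
        + a ^ (1 / 2 : ℝ) / t
        + a ^ (-(1 / 2 : ℝ)) / 2
        + (N : ℝ) ^ (-(1 / 2 : ℝ)) / 2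
        + (4 * (N : ℝ) ^ (-(1 / 2 : ℝ)) / π * (1 + Real.log (⌊y⌋₊ + 1)) + a ^ (-(1 / 2 : ℝ)) / (2 * π)
            + 2 * a ^ (-(1 / 2 : ℝ)) / π * (1 / δ + 1 + Real.log (y + 1)))
        + 3 * (X : ℝ) ^ (-(1 / 2 : ℝ))
        + ((N : ℝ) ^ (-(1 / 2 : ℝ)) + a ^ (-(1 / 2 : ℝ))) / (2 * π) * (1 + Real.log (⌊y⌋₊ + 1))
        + ‖s‖ * a ^ (-(1 / 2 : ℝ) - 1) / π ^ 2 * ((1 / δ + 2 + Real.log (y + 2)) / y)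
        + (2 * ‖s‖ * a ^ (-(1 / 2 : ℝ)) / (π * t) * (1 + Real.log (⌊y⌋₊ + 1))
            + ‖s‖ * a ^ (-(1 / 2 : ℝ) - 1) / π ^ 2 * (1 / ⌊y⌋₊)) := by
  -- basic facts about `s`
  have hsre : s.re = 1 / 2 := by rw [hs]; simp
  have hsim : s.im = t := by rw [hs]; simp
  have hσ0 : 0 < s.re := by rw [hsre]; norm_num
  have hσ1 : s.re < 1 := by rw [hsre]; norm_num
  have hs1 : s ≠ 1 := by
    intro h; rw [h] at hsim; simp at hsim; linarith
  have hy0 : 0 < y := by linarith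
  have hty' : s.im = 2 * π * a * y := by rw [hsim, hty]
  have hNreal : a ≤ (N : ℝ) := haN
  have hX1R : (1 : ℝ) ≤ X := by exact_mod_cast hX1
  have hNpos : (0 : ℝ) < N := ha.trans_le haN
  have hN1 : 1 ≤ N := by exact_mod_cast (show (0 : ℝ) < N from hNpos)
  have htN' : s.im ≤ π * N := by rw [hsim]; exact htN
  have hfl1 : 1 ≤ ⌊y⌋₊ := Nat.le_floor (by exact_mod_cast hy)
  -- names for the pieces
  set C : ℂ := afeCoeff s with hC
  set S1 : ℂ := ∑ n ∈ Finset.Icc 1 X, (n : ℂ) ^ (-s) with hS1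
  set S2 : ℂ := ∑ n ∈ Finset.Ioc X ⌊a⌋₊, (n : ℂ) ^ (-s) with hS2
  set S3 : ℂ := ∑ n ∈ Finset.Ioc ⌊a⌋₊ N, (n : ℂ) ^ (-s) with hS3
  set SN : ℂ := ∑ n ∈ Finset.Icc 1 N, (n : ℂ) ^ (-s) with hSN
  set Ip : ℕ → ℂ := fun ν => ∫ u in a..N, (u : ℂ) ^ (-s - 1)
    * Complex.exp (((2 * π * ν * u : ℝ) : ℂ) * I) with hIp
  set In : ℕ → ℂ := fun ν => ∫ u in a..N, (u : ℂ) ^ (-s - 1)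
    * Complex.exp (((-(2 * π * ν) * u : ℝ) : ℂ) * I) with hIn
  set J : ℕ → ℂ := fun ν => ∫ u in a..N, (u : ℂ) ^ (-s)
    * Complex.exp (((2 * π * ν * u : ℝ) : ℂ) * I) with hJ
  set Bd : ℕ → ℂ := fun ν => ((N : ℂ) ^ (-s) * Complex.exp (((2 * π * ν * N : ℝ) : ℂ) * I)
    - (a : ℂ) ^ (-s) * Complex.exp (((2 * π * ν * a : ℝ) : ℂ) * I)) / (2 * π * I * ν) with hBd
  set cν : ℕ → ℂ := fun ν => 1 / (2 * π * I * ν) with hcν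
  set NearP : ℂ := ∑ ν ∈ Finset.Icc 1 ⌊y⌋₊, s * (cν ν * Ip ν) with hNearP
  set FarP : ℂ := ∑ ν ∈ Finset.Icc (⌊y⌋₊ + 1) V, s * (cν ν * Ip ν) with hFarP
  set Neg : ℂ := ∑ ν ∈ Finset.Icc 1 V, s * (cν ν * In ν) with hNeg
  set JS : ℂ := ∑ ν ∈ Finset.Icc 1 ⌊y⌋₊, J ν with hJS
  set BS : ℂ := ∑ ν ∈ Finset.Icc 1 ⌊y⌋₊, Bd ν with hBS
  set CY : ℂ := C * ∑ ν ∈ Finset.Icc 1 ⌊y⌋₊, (ν : ℂ) ^ (s - 1) with hCY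
  set MainA : ℂ := ((N : ℂ) ^ (1 - s) - (a : ℂ) ^ (1 - s)) / (1 - s)
    + (saw a : ℂ) * (a : ℂ) ^ (-s) - (saw N : ℂ) * (N : ℂ) ^ (-s)
    + s * ∑ ν ∈ Finset.Icc 1 V, cν ν * (Ip ν - In ν) with hMainA
  set RA : ℂ := S3 - MainA with hRA
  set EM : ℂ := riemannZeta s - SN + (N : ℂ) ^ (1 - s) / (1 - s) with hEM
  -- (1) the sums of `n^{-s}` combine
  have hXfa : X ≤ ⌊a⌋₊ := Nat.le_floor hXa
  have hfaN : ⌊a⌋₊ ≤ N := by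
    have := Nat.floor_le_floor hNreal
    rwa [Nat.floor_natCast] at this
  have hfaX : ⌊a⌋₊ ≤ X + 1 := by
    have := Nat.floor_le_floor haX
    rwa [show (X : ℝ) + 1 = ((X + 1 : ℕ) : ℝ) by push_cast; ring, Nat.floor_natCast] at this
  have hSsplit : SN = S1 + S2 + S3 := by
    simp only [hSN, hS1, hS2, hS3]
    rw [show Finset.Icc 1 N = Finset.Ioc 0 N from rfl, show Finset.Icc 1 X = Finset.Ioc 0 X from rfl,
      ← Finset.sum_Ioc_consecutive _ (Nat.zero_le X) (hXfa.trans hfaN),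
      ← Finset.sum_Ioc_consecutive _ hXfa hfaN, add_assoc]
  -- (2) split of the frequency sum
  have hVsplit : s * ∑ ν ∈ Finset.Icc 1 V, cν ν * (Ip ν - In ν) = NearP + FarP - Neg := by
    simp only [hNearP, hFarP, hNeg]
    rw [Finset.mul_sum]
    have e : ∀ ν : ℕ, s * (cν ν * (Ip ν - In ν)) = s * (cν ν * Ip ν) - s * (cν ν * In ν) := by
      intro ν; ring
    simp only [e, Finset.sum_sub_distrib]
    rw [show Finset.Icc 1 V = Finset.Ioc 0 V from rfl,
      show Finset.Icc 1 ⌊y⌋₊ = Finset.Ioc 0 ⌊y⌋₊ from rfl,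
      Finset.Icc_add_one_left_eq_Ioc ⌊y⌋₊ V,
      ← Finset.sum_Ioc_consecutive _ (Nat.zero_le _) hyV]
  -- (3) the near terms
  have hnear : NearP = JS - BS := by
    simp only [hNearP, hJS, hBS, ← Finset.sum_sub_distrib]
    apply Finset.sum_congr rfl
    intro ν hν
    have hν : (ν : ℝ) ≠ 0 := by
      have := (Finset.mem_Icc.1 hν).1
      exact_mod_cast (show ν ≠ 0 by omega)
    have h := near_term_identity s ha hNreal hν
    simp only [hcν, hIp, hJ, hBd]
    convert h using 2 <;> push_cast <;> ring_nf
  -- (4) the identity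
  set T4e : ℂ := -((a : ℂ) ^ (1 - s) / (1 - s)) with hT4e
  set T5e : ℂ := (saw a : ℂ) * (a : ℂ) ^ (-s) with hT5e
  set T6e : ℂ := -((saw N : ℂ) * (N : ℂ) ^ (-s)) with hT6e
  have hident : riemannZeta s - S1 - CY
      = EM + S2 + RA + T4e + T5e + T6e + (JS - CY) + (-BS) + FarP + (-Neg) := by
    simp only [hEM, hRA, hMainA, hSsplit, hVsplit, hnear, hT4e, hT5e, hT6e]
    ring
  -- (5) the ten bounds
  have hnorm_cpow_a : ∀ w : ℂ, ‖(a : ℂ) ^ w‖ = a ^ w.re := fun w =>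
    Complex.norm_cpow_eq_rpow_re_of_pos ha w
  have hnorm_cpow_N : ∀ w : ℂ, ‖(N : ℂ) ^ w‖ = (N : ℝ) ^ w.re := fun w => by
    rw [show (N : ℂ) = ((N : ℝ) : ℂ) by simp, Complex.norm_cpow_eq_rpow_re_of_pos hNpos]
  have hT1 : ‖EM‖ ≤ (N : ℝ) ^ (-(1 / 2 : ℝ)) * (1 / 2 + ‖s‖) := by
    have h := norm_zeta_sub_sum_add_le hσ0 hs1 hN1
    rw [hsre] at h
    simp only [hEM, hSN]
    convert h using 2; norm_num
  have hT2 : ‖S2‖ ≤ (X : ℝ) ^ (-(1 / 2 : ℝ)) := by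
    have h := norm_sum_Ioc_cpow_le (w := -s) (by simp [hsre]) X ⌊a⌋₊
    simp only [hS2]
    refine h.trans ?_
    have hcard : ((⌊a⌋₊ - X : ℕ) : ℝ) ≤ 1 := by
      have : ⌊a⌋₊ - X ≤ 1 := by omega
      exact_mod_cast this
    have hXpos : (0 : ℝ) < X := by linarith
    have hbase : ((X : ℝ) + 1) ^ (-(1 / 2 : ℝ)) ≤ (X : ℝ) ^ (-(1 / 2 : ℝ)) :=
      Real.rpow_le_rpow_of_nonpos hXpos (by linarith) (by norm_num)
    have h0 : (0 : ℝ) ≤ ((X : ℝ) + 1) ^ (-(1 / 2 : ℝ)) := by positivity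
    nlinarith
  have hT3 : ‖RA‖ ≤ ‖s‖ * a ^ (-(1 / 2 : ℝ) - 1) * (N - a + 2) * sawEta V := by
    have h := norm_sum_Ioc_cpow_sub_expansion_le hσ0 hs1 ha hNreal hV1 (V := V)
    rw [hsre] at h
    simp only [hRA, hMainA, hS3, hcν, hIp, hIn]
    exact h
  have h1s_ge : t ≤ ‖1 - s‖ := by
    have := Complex.abs_im_le_norm (1 - s)
    simp only [sub_im, one_im, zero_sub, abs_neg, hsim] at this
    rwa [abs_of_pos ht0] at this
  have hT4 : ‖T4e‖ ≤ a ^ (1 / 2 : ℝ) / t := by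
    simp only [hT4e]
    rw [norm_neg, norm_div, hnorm_cpow_a]
    simp only [sub_re, one_re, hsre]
    norm_num
    exact div_le_div_of_nonneg_left (by positivity) ht0 h1s_ge
  have hT5 : ‖T5e‖ ≤ a ^ (-(1 / 2 : ℝ)) / 2 := by
    simp only [hT5e]
    rw [norm_mul, hnorm_cpow_a, Complex.norm_real, Real.norm_eq_abs, neg_re, hsre]
    have := abs_saw_le a
    have h0 : (0 : ℝ) ≤ a ^ (-(1 / 2 : ℝ)) := by positivity
    nlinarith
  have hT6 : ‖T6e‖ ≤ (N : ℝ) ^ (-(1 / 2 : ℝ)) / 2 := by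
    simp only [hT6e]
    rw [norm_neg, norm_mul, hnorm_cpow_N, Complex.norm_real, Real.norm_eq_abs, neg_re, hsre]
    have := abs_saw_le (N : ℝ)
    have h0 : (0 : ℝ) ≤ (N : ℝ) ^ (-(1 / 2 : ℝ)) := by positivity
    nlinarith
  have hT7 : ‖JS - CY‖ ≤ 4 * (N : ℝ) ^ (-(1 / 2 : ℝ)) / π * (1 + Real.log (⌊y⌋₊ + 1))
      + a ^ (-(1 / 2 : ℝ)) / (2 * π) + 2 * a ^ (-(1 / 2 : ℝ)) / π * (1 / δ + 1 + Real.log (y + 1)) := by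
    have h := norm_sum_near_sub_le_of_gap hσ0 hσ1 ha hy hδ hty' hfr1 hNreal htN'
    rw [hsre] at h
    simp only [hJS, hCY, hJ, hC]
    exact h
  have hT8 : (0 : ℝ) ≤ 3 * (X : ℝ) ^ (-(1 / 2 : ℝ)) := by positivity
  have hT9 : ‖-BS‖ ≤ ((N : ℝ) ^ (-(1 / 2 : ℝ)) + a ^ (-(1 / 2 : ℝ))) / (2 * π)
      * (1 + Real.log (⌊y⌋₊ + 1)) := by
    rw [norm_neg]
    have h := norm_sum_boundary_le (s := s) ha hNpos ⌊y⌋₊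
    rw [hsre] at h
    simp only [hBS, hBd]
    exact (norm_sum_le _ _).trans h
  have hT10 : ‖FarP‖ ≤ ‖s‖ * a ^ (-(1 / 2 : ℝ) - 1) / π ^ 2 * ((1 / δ + 2 + Real.log (y + 2)) / y) := by
    have h := norm_sum_far_pos_le_of_gap hσ0 ha hy0 hδ hty' hfr2 hNreal (V := V)
    rw [hsre] at h
    simp only [hFarP, hcν, hIp]
    exact (norm_sum_le _ _).trans h
  have hT11 : ‖-Neg‖ ≤ 2 * ‖s‖ * a ^ (-(1 / 2 : ℝ)) / (π * t) * (1 + Real.log (⌊y⌋₊ + 1))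
      + ‖s‖ * a ^ (-(1 / 2 : ℝ) - 1) / π ^ 2 * (1 / ⌊y⌋₊) := by
    rw [norm_neg]
    have h := norm_sum_far_neg_le hσ0 ha hy hty' hNreal (V := V)
    rw [hsre, hsim] at h
    simp only [hNeg, hcν, hIn]
    exact (norm_sum_le _ _).trans h
  -- (6) add up
  rw [hident]
  have e10 := norm_add_le (EM + S2 + RA + T4e + T5e + T6e + (JS - CY) + (-BS) + FarP) (-Neg)
  have e9 := norm_add_le (EM + S2 + RA + T4e + T5e + T6e + (JS - CY) + (-BS)) FarP
  have e8 := norm_add_le (EM + S2 + RA + T4e + T5e + T6e + (JS - CY)) (-BS)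
  have e6 := norm_add_le (EM + S2 + RA + T4e + T5e + T6e) (JS - CY)
  have e5 := norm_add_le (EM + S2 + RA + T4e + T5e) T6e
  have e4 := norm_add_le (EM + S2 + RA + T4e) T5e
  have e3 := norm_add_le (EM + S2 + RA) T4e
  have e2 := norm_add_le (EM + S2) RA
  have e1 := norm_add_le EM S2
  linarith

/-! ## The auxiliary abscissa near a given length -/

/-! ## Letting `N, V → ∞`: the usable form -/

/-- The master inequality with the `a`-terms collected: for the data of
`norm_zeta_sub_sub_le_master_unbalanced_of_gap`,
`‖ζ(s) − ∑_{n≤X} n^{−s} − afeCoeff(s)∑_{ν≤[y]} ν^{s−1}‖ ≤ 4X^{−1/2} + a^{−1/2}(2/δ + 9 + 4 log(y+2))`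
`+ N^{−1/2}(1 + |s| + (4/π + 1/(2π))(1 + log([y]+1))) + |s| a^{−3/2}(N − a + 2) η_V`. [cite: Titchmarsh1986, Theorem 4.13] -/
theorem norm_zeta_sub_sub_le_of_gap_aux {t a y δ : ℝ} {X N V : ℕ} (ht0 : 0 < t) (ha : 0 < a)
    (hy : 1 ≤ y) (hδ : 0 < δ) (hty : t = 2 * π * a * y) (hfr1 : δ ≤ Int.fract y)
    (hfr2 : Int.fract y ≤ 1 - δ) (hXa : (X : ℝ) ≤ a) (haX : a ≤ X + 1) (hX1 : 1 ≤ X)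
    (haN : a ≤ N) (htN : t ≤ π * N) (hV1 : 1 ≤ V) (hyV : ⌊y⌋₊ ≤ V) (s : ℂ) (hs : s = 1 / 2 + t * I) :
    ‖riemannZeta s - ∑ n ∈ Finset.Icc 1 X, (n : ℂ) ^ (-s)
        - afeCoeff s * ∑ n ∈ Finset.Icc 1 ⌊y⌋₊, (n : ℂ) ^ (s - 1)‖
      ≤ 4 * (X : ℝ) ^ (-(1 / 2 : ℝ)) + a ^ (-(1 / 2 : ℝ)) * (2 / δ + 9 + 4 * Real.log (y + 2))
        + ((N : ℝ) ^ (-(1 / 2 : ℝ)) * (1 + ‖s‖ + (4 / π + 1 / (2 * π)) * (1 + Real.log (⌊y⌋₊ + 1)))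
          + ‖s‖ * a ^ (-(1 / 2 : ℝ) - 1) * (N - a + 2) * sawEta V) := by
  have hπ := Real.pi_gt_three
  have hX1R : (1 : ℝ) ≤ X := by exact_mod_cast hX1
  have ht6 : 6 * a ≤ t := by
    have h3 : 3 * 1 ≤ π * y := mul_le_mul hπ.le hy zero_le_one (by linarith)
    rw [hty]; nlinarith [h3, ha]
  have hy0 : 0 < y := by linarith
  have hsnorm : ‖s‖ ≤ 1 / 2 + t := by
    rw [hs]
    calc ‖(1 / 2 : ℂ) + t * I‖ ≤ ‖(1 / 2 : ℂ)‖ + ‖(t : ℂ) * I‖ := norm_add_le _ _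
      _ = 1 / 2 + t := by
          rw [norm_mul, Complex.norm_I, mul_one, Complex.norm_real, Real.norm_eq_abs, abs_of_pos ht0]
          norm_num
  have hs2t : ‖s‖ ≤ 2 * t := by linarith
  have hfl1 : 1 ≤ ⌊y⌋₊ := Nat.le_floor (by exact_mod_cast hy)
  have hfl2 : y ≤ 2 * ⌊y⌋₊ := by
    have := Nat.lt_floor_add_one y
    have : (1 : ℝ) ≤ ⌊y⌋₊ := by exact_mod_cast hfl1
    linarith
  have hlog1 : Real.log (⌊y⌋₊ + 1) ≤ Real.log (y + 2) :=
    Real.log_le_log (by positivity) (by linarith [Nat.floor_le hy0.le])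
  have hlog2 : Real.log (y + 1) ≤ Real.log (y + 2) := Real.log_le_log (by linarith) (by linarith)
  have hlog0 : 0 ≤ Real.log (y + 2) := Real.log_nonneg (by linarith)
  have hlogf0 : 0 ≤ Real.log ((⌊y⌋₊ : ℝ) + 1) := Real.log_nonneg (by linarith)
  set A : ℝ := a ^ (-(1 / 2 : ℝ)) with hA
  have hapow : 0 < A := Real.rpow_pos_of_pos ha _
  have ha32 : a ^ (-(1 / 2 : ℝ) - 1) = A / a := by rw [Real.rpow_sub ha, Real.rpow_one]
  have ha12 : a ^ (1 / 2 : ℝ) = A * a := by rw [hA, ← Real.rpow_add_one ha.ne']; norm_num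
  set EN : ℝ := (N : ℝ) ^ (-(1 / 2 : ℝ)) with hEN
  have hEN0 : 0 ≤ EN := by positivity
  have b4 : a ^ (1 / 2 : ℝ) / t ≤ A / 6 := by
    rw [ha12, div_le_div_iff₀ ht0 (by norm_num)]
    have := mul_le_mul_of_nonneg_left ht6 hapow.le
    linarith
  have b7b : A / (2 * π) ≤ A / 6 := div_le_div_of_nonneg_left hapow.le (by norm_num) (by linarith)
  have b7c : 2 * A / π * (1 / δ + 1 + Real.log (y + 1)) ≤
      2 / 3 * (A * (1 / δ)) + 2 / 3 * A + 2 / 3 * (A * Real.log (y + 2)) := by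
    have : 0 ≤ Real.log (y + 1) := Real.log_nonneg (by linarith)
    have hQ : 0 ≤ 1 / δ + 1 + Real.log (y + 1) := by positivity
    calc 2 * A / π * (1 / δ + 1 + Real.log (y + 1)) ≤ 2 * A / 3 * (1 / δ + 1 + Real.log (y + 1)) :=
          mul_le_mul_of_nonneg_right (div_le_div_of_nonneg_left (by positivity) (by norm_num) hπ.le) hQ
      _ ≤ 2 * A / 3 * (1 / δ + 1 + Real.log (y + 2)) := by gcongr
      _ = _ := by ring
  have b9 : (EN + A) / (2 * π) * (1 + Real.log (⌊y⌋₊ + 1)) ≤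
      EN / (2 * π) * (1 + Real.log (⌊y⌋₊ + 1)) + (1 / 6 * A + 1 / 6 * (A * Real.log (y + 2))) := by
    have h1 : (EN + A) / (2 * π) * (1 + Real.log (⌊y⌋₊ + 1)) =
        EN / (2 * π) * (1 + Real.log (⌊y⌋₊ + 1)) + A / (2 * π) * (1 + Real.log (⌊y⌋₊ + 1)) := by ring
    rw [h1]
    have h2 : A / (2 * π) * (1 + Real.log (⌊y⌋₊ + 1)) ≤ A / 6 * (1 + Real.log (y + 2)) :=
      mul_le_mul b7b (by linarith) (by positivity) (by positivity)
    linarith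
  have b10 : ‖s‖ * a ^ (-(1 / 2 : ℝ) - 1) / π ^ 2 * ((1 / δ + 2 + Real.log (y + 2)) / y) ≤
      4 / 3 * (A * (1 / δ)) + 8 / 3 * A + 4 / 3 * (A * Real.log (y + 2)) := by
    rw [ha32]
    have hQ : 0 ≤ 1 / δ + 2 + Real.log (y + 2) := by positivity
    have h1 : ‖s‖ * (A / a) / π ^ 2 * ((1 / δ + 2 + Real.log (y + 2)) / y) =
        (‖s‖ / (a * y)) * (1 / π ^ 2) * (A * (1 / δ + 2 + Real.log (y + 2))) := by field_simp
    rw [h1]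
    have h2 : ‖s‖ / (a * y) ≤ 4 * π := by
      rw [div_le_iff₀ (by positivity)]
      calc ‖s‖ ≤ 2 * t := hs2t
        _ = 4 * π * (a * y) := by rw [hty]; ring
    have h3 : 1 / π ^ 2 ≤ 1 / (3 * π) :=
      div_le_div_of_nonneg_left (by norm_num) (by positivity)
        (by rw [sq]; exact mul_le_mul_of_nonneg_right hπ.le (by positivity))
    calc ‖s‖ / (a * y) * (1 / π ^ 2) * (A * (1 / δ + 2 + Real.log (y + 2)))
        ≤ 4 * π * (1 / (3 * π)) * (A * (1 / δ + 2 + Real.log (y + 2))) := by gcongr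
      _ = _ := by field_simp; ring
  have b11a : 2 * ‖s‖ * A / (π * t) * (1 + Real.log (⌊y⌋₊ + 1)) ≤ 4 / 3 * A + 4 / 3 * (A * Real.log (y + 2)) := by
    have h1 : 2 * ‖s‖ * A / (π * t) = (‖s‖ / t) * (1 / π) * (2 * A) := by field_simp
    rw [h1]
    have h2 : ‖s‖ / t ≤ 2 := by rw [div_le_iff₀ ht0]; linarith
    have h3 : 1 / π ≤ 1 / 3 := div_le_div_of_nonneg_left (by norm_num) (by norm_num) hπ.le
    have h4 : 0 ≤ 1 + Real.log ((⌊y⌋₊ : ℝ) + 1) := by positivity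
    calc ‖s‖ / t * (1 / π) * (2 * A) * (1 + Real.log (⌊y⌋₊ + 1))
        ≤ 2 * (1 / 3) * (2 * A) * (1 + Real.log (y + 2)) := by gcongr
      _ = _ := by ring
  have b11b : ‖s‖ * a ^ (-(1 / 2 : ℝ) - 1) / π ^ 2 * (1 / ⌊y⌋₊) ≤ 8 / 3 * A := by
    rw [ha32]
    have hfl0 : (0 : ℝ) < ⌊y⌋₊ := by exact_mod_cast hfl1
    have h1 : ‖s‖ * (A / a) / π ^ 2 * (1 / ⌊y⌋₊) = (‖s‖ / (a * ⌊y⌋₊)) * (1 / π ^ 2) * A := by field_simp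
    rw [h1]
    have h2 : ‖s‖ / (a * ⌊y⌋₊) ≤ 8 * π := by
      rw [div_le_iff₀ (by positivity)]
      have h4 : 4 * π * a * y ≤ 4 * π * a * (2 * ⌊y⌋₊) := mul_le_mul_of_nonneg_left hfl2 (by positivity)
      calc ‖s‖ ≤ 2 * t := hs2t
        _ = 4 * π * a * y := by rw [hty]; ring
        _ ≤ 8 * π * (a * ⌊y⌋₊) := by linarith
    have h3 : 1 / π ^ 2 ≤ 1 / (3 * π) :=
      div_le_div_of_nonneg_left (by norm_num) (by positivity)
        (by rw [sq]; exact mul_le_mul_of_nonneg_right hπ.le (by positivity))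
    calc ‖s‖ / (a * ⌊y⌋₊) * (1 / π ^ 2) * A ≤ 8 * π * (1 / (3 * π)) * A := by gcongr
      _ = _ := by field_simp
  have e : A * (2 / δ + 9 + 4 * Real.log (y + 2)) =
      2 * (A * (1 / δ)) + 9 * A + 4 * (A * Real.log (y + 2)) := by ring
  have eN : EN * (1 / 2 + ‖s‖) + EN / 2 + 4 * EN / π * (1 + Real.log (⌊y⌋₊ + 1)) +
      EN / (2 * π) * (1 + Real.log (⌊y⌋₊ + 1)) =
      EN * (1 + ‖s‖ + (4 / π + 1 / (2 * π)) * (1 + Real.log (⌊y⌋₊ + 1))) := by ring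
  have hX0 : 0 ≤ (X : ℝ) ^ (-(1 / 2 : ℝ)) := by positivity
  have hδA : 0 ≤ A * (1 / δ) := by positivity
  have hLA : 0 ≤ A * Real.log (y + 2) := by positivity
  have hM := norm_zeta_sub_sub_le_master_unbalanced_of_gap ht0 ha hy hδ hty hfr1 hfr2 hXa haX hX1
    haN htN hV1 hyV s hs
  rw [← hA, ← hEN] at hM
  rw [e]
  linarith [hM, b4, b7b, b7c, b9, b10, b11a, b11b, eN, hX0, hδA, hLA, hapow.le]
/-- **Theorem 4.13 at `σ = 1/2`, unbalanced, variable gap — usable form.** For `t = 2πay` with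
`y ≥ 1`, `δ ≤ {y} ≤ 1 − δ` (`δ > 0`), `a ∈ [X, X+1]`, `X ≥ 1`, `s = 1/2 + it`:
`‖ζ(s) − ∑_{n≤X} n^{−s} − afeCoeff(s) ∑_{ν≤[y]} ν^{s−1}‖ ≤ 4X^{−1/2} + a^{−1/2}(2/δ + 9 + 4 log(y+2))`
(the free parameters `N, V` of the master inequality are sent to infinity). [cite: Titchmarsh1986, Theorem 4.13] -/
theorem approxFunctionalEq_half_of_gap {t a y δ : ℝ} {X : ℕ} (ha : 0 < a) (hy : 1 ≤ y)
    (hδ : 0 < δ) (hty : t = 2 * π * a * y) (hfr1 : δ ≤ Int.fract y) (hfr2 : Int.fract y ≤ 1 - δ)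
    (hXa : (X : ℝ) ≤ a) (haX : a ≤ X + 1) (hX1 : 1 ≤ X) (s : ℂ) (hs : s = 1 / 2 + t * I) :
    ‖riemannZeta s - ∑ n ∈ Finset.Icc 1 X, (n : ℂ) ^ (-s)
        - afeCoeff s * ∑ n ∈ Finset.Icc 1 ⌊y⌋₊, (n : ℂ) ^ (s - 1)‖
      ≤ 4 * (X : ℝ) ^ (-(1 / 2 : ℝ)) + a ^ (-(1 / 2 : ℝ)) * (2 / δ + 9 + 4 * Real.log (y + 2)) := by
  have hπ := Real.pi_gt_three
  have ht0 : 0 < t := by rw [hty]; positivity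
  have hX1R : (1 : ℝ) ≤ X := by exact_mod_cast hX1
  refine le_of_forall_pos_le_add fun η hη ↦ ?_
  set CN : ℝ := 1 + ‖s‖ + (4 / π + 1 / (2 * π)) * (1 + Real.log (⌊y⌋₊ + 1)) with hCN
  have hlogf0 : 0 ≤ Real.log ((⌊y⌋₊ : ℝ) + 1) := Real.log_nonneg (by linarith [Nat.cast_nonneg (α := ℝ) ⌊y⌋₊])
  have hCN0 : 0 < CN := by rw [hCN]; positivity
  have hNlim : Tendsto (fun N : ℕ ↦ (N : ℝ) ^ (-(1 / 2 : ℝ)) * CN) atTop (nhds 0) := by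
    have h := (tendsto_rpow_neg_atTop (by norm_num : (0 : ℝ) < 1 / 2)).comp tendsto_natCast_atTop_atTop
    simpa using h.mul_const CN
  obtain ⟨N₀, hN₀⟩ := (hNlim.eventually (gt_mem_nhds (show (0 : ℝ) < η / 2 by positivity))).exists_forall_of_atTop
  set N : ℕ := max N₀ (max ⌈a⌉₊ ⌈t / π⌉₊) with hN
  have hN₀N : N₀ ≤ N := le_max_left _ _
  have haN : a ≤ N := (Nat.le_ceil a).trans (by exact_mod_cast (le_max_left _ _).trans (le_max_right N₀ _))
  have htN : t ≤ π * N := by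
    have h1 : t / π ≤ ⌈t / π⌉₊ := Nat.le_ceil _
    have h2 : (⌈t / π⌉₊ : ℝ) ≤ N := by exact_mod_cast (le_max_right _ _).trans (le_max_right N₀ _)
    rw [div_le_iff₀ (by positivity)] at h1
    nlinarith
  have hNterm : (N : ℝ) ^ (-(1 / 2 : ℝ)) * CN < η / 2 := hN₀ N hN₀N
  set K : ℝ := ‖s‖ * a ^ (-(1 / 2 : ℝ) - 1) * (N - a + 2) with hK
  have hNa2 : 0 ≤ (N : ℝ) - a + 2 := by linarith
  have hK0 : 0 ≤ K := by rw [hK]; positivity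
  obtain ⟨V₀, hV₀1, hV₀⟩ := exists_sawEta_le (δ := η / 2 / (K + 1)) (by positivity)
  set V : ℕ := max V₀ ⌊y⌋₊ with hV
  have hV1 : 1 ≤ V := hV₀1.trans (le_max_left _ _)
  have hyV : ⌊y⌋₊ ≤ V := le_max_right _ _
  have hηV : sawEta V ≤ η / 2 / (K + 1) := hV₀ V (le_max_left _ _)
  have hKV : K * sawEta V ≤ η / 2 := by
    calc K * sawEta V ≤ (K + 1) * (η / 2 / (K + 1)) :=
          mul_le_mul (by linarith) hηV (sawEta_nonneg _) (by positivity)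
      _ = η / 2 := by field_simp
  have hM := norm_zeta_sub_sub_le_of_gap_aux ht0 ha hy hδ hty hfr1 hfr2 hXa haX hX1 haN htN hV1 hyV s hs
  rw [← hCN, ← hK] at hM
  linarith

end Literature.NumberTheory.LFunctions.AFE

end
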